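import Mathlib.Data.Prod.Lex
import Mathlib.Order.WithBot
import Mathlib.Order.WellFounded
import Mathlib.Data.Rat.Cast.Order
import HarnessLib

/-!
# Cossart–Schober: the invariant `ι = (ι₀, ι_c, ι_poly)` in dimension two — value types, assembly, Theorem 1

Source: V. Cossart, B. Schober, *A strictly decreasing invariant for resolution of singularities in
dimension two*, Publ. RIMS 56 (2020) 217–280, doi:10.4171/prims/56-2-1, arXiv:1411.4452
[`CossartSchober2020`]: Definition 1.27 (`ι₀ = (H_X(x), |O_X(x)|, e_X(x), e^O_X(x))`),
Notation 4.1 (Cases (I)–(V) of a point with respect to the old Hilbert–Samuel locus `C`),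
Definition 4.3 (`ι_c`), Definition 5.1 (`ι_poly` for `e^O_X(x) ≤ 1`), Definition 5.5 (`ι_poly` for
`e^O_X(x) = e_X(x) = 2`, with the condition (ALL_Irred_NEW) of §5), and Theorem 1: "Let `X ⊂ Z`,
`𝓑` a boundary on `Z`, and `π_Z : Z' → Z` be the blow-up with center `D ⊂ X` following the
algorithm of [CJS]. Let `x ∈ D` and `x' ∈ π_Z⁻¹(x)`. Then `ι(X', 𝓑', x') < ι(X, 𝓑, x)`."
(`X` reduced excellent of dimension at most two, `ι` ordered lexicographically.)

This file types the VALUES of the invariant and the way the published definitions ASSEMBLE them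
from their ingredients (the Hilbert–Samuel function, the numbers `|O|`, `e`, `e^O`, Hironaka's
`δ`, and the polyhedron numbers `β, γ, σ, α` of Definition 3.17 / (5.4)), states Theorem 1 as a
NAMED FACT over abstract sequence data (no semantics of the [CJS] algorithm is asserted), and PROVES
the order-theoretic half of the termination argument: a function that strictly decreases along a
relation and takes values in a well-founded order admits no infinite chain; the grid
`ν × ℕ³ × (ν × ℕ³ × ℕ∞²) × ℕ∞⁴` (rational entries with bounded denominator, cf. Corollary 3.10
"`δ ∈ (1/N!)ℤ`") is well-founded when the type `ν` of Hilbert–Samuel values is.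
The ingredients themselves (Hilbert–Samuel functions, directrix, characteristic polyhedron) are
NOT formalised here; for the polyhedron numbers on the cell's hypersurfaces see
`KangarooAtlasCertPolygon.lean`, for `O(x)`, `H^O` see `BoundaryHistoryFunction.lean`.
-/

namespace Literature.AlgebraicGeometry.Resolution.CossartSchober

/-- `ℚ_∞ := ℚ_{≥ 0} ∪ {∞}` of [CS20] Definition 3.9 (`δ(I;u) ∈ ℚ_∞`); typed as `WithTop ℚ`
(negative values are simply never produced). [cite: CossartSchober2020, Def. 3.9] -/
abbrev Qinf := WithTop ℚ

/-- Value type of `ι₀(X, 𝓑, x) = (H_X(x), |O_X(x)|, e_X(x), e^O_X(x)) ∈ ℕ^ℕ × ℕ³`, ordered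
lexicographically; `ν` is the ordered type of Hilbert–Samuel functions.
[cite: CossartSchober2020, Def. 1.27] -/
abbrev IotaZero (ν : Type*) := ν ×ₗ ℕ ×ₗ ℕ ×ₗ ℕ

/-- Value type of `ι_c(X, 𝓑, x) ∈ ℕ^ℕ × ℕ³ × ℚ_∞²` (in Case (III):
`(H_C(x), |O_C(x)|, e_C(x), e^O_C(x), δ_C(x), δ^O_C(x))`), ordered lexicographically.
[cite: CossartSchober2020, Def. 4.3] -/
abbrev IotaC (ν : Type*) := ν ×ₗ ℕ ×ₗ ℕ ×ₗ ℕ ×ₗ Qinf ×ₗ Qinf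

/-- Value type of `ι_poly(X, 𝓑, x) ∈ ℚ_∞⁴` (`(β^O, γ^O, σ^O, α^O)` of a new component, or the
constant tuples of Definitions 5.1 / 5.5), ordered lexicographically.
[cite: CossartSchober2020, Def. 5.1, Def. 5.5] -/
abbrev IotaPolyVal := Qinf ×ₗ Qinf ×ₗ Qinf ×ₗ Qinf

/-- Value type of the complete invariant `ι = (ι₀, ι_c, ι_poly)` with the lexicographic order
used in Theorem 1. [cite: CossartSchober2020, §1 (Theorem 1), Def. 1.27, Def. 4.3, Def. 5.5] -/
abbrev Iota (ν : Type*) := IotaZero ν ×ₗ IotaC ν ×ₗ IotaPolyVal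

/-- Constructor of an `ι₀` value from its four entries. [cite: CossartSchober2020, Def. 1.27] -/
def IotaZero.mk {ν : Type*} (H : ν) (nOld e eO : ℕ) : IotaZero ν :=
  toLex (H, toLex (nOld, toLex (e, eO)))

/-- Constructor of an `ι_c` value from its six entries. [cite: CossartSchober2020, Def. 4.3] -/
def IotaC.mk {ν : Type*} (H : ν) (nOld e eO : ℕ) (δ δO : Qinf) : IotaC ν :=
  toLex (H, toLex (nOld, toLex (e, toLex (eO, toLex (δ, δO)))))

/-- Constructor of an `ι_poly` value `(β, γ, σ, α)`. [cite: CossartSchober2020, Def. 5.5] -/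
def IotaPolyVal.mk (β γ σ α : Qinf) : IotaPolyVal :=
  toLex (β, toLex (γ, toLex (σ, α)))

/-- Constructor of the complete invariant. [cite: CossartSchober2020, Theorem 1] -/
def Iota.mk {ν : Type*} (i₀ : IotaZero ν) (ic : IotaC ν) (ip : IotaPolyVal) : Iota ν :=
  toLex (i₀, toLex (ic, ip))

/-- The five cases of a closed point `x ∈ X` relative to the strict transform `C` of the old
maximal log-Hilbert–Samuel locus `C_* = X^O_*(ν̃) ∩ U_*`: (I) `x = C` a closed point; (II) `x ∈ C`,
`C` a curve `𝓑`-permissible at `x`; (III) `C` reducible at `x`, or irreducible and not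
`𝓑`-permissible at `x`; (IV) `x ∉ C`; (V) `x ∈ C`, `dim C = 2`.
[cite: CossartSchober2020, Notation 4.1] -/
inductive HSCase
  | I | II | III | IV | V
  deriving DecidableEq, Repr

/-- Definition 4.3: `ι_c := (0,…,0,0,0,0,0)` in Cases (IV), (V); `(0,…,0,0,0,0,1)` in Cases (I),
(II); the datum `(H_C, |O_C|, e_C, e^O_C, δ_C, δ^O_C)` of `C` at `x` in Case (III).  `zero : ν` is
the zero Hilbert–Samuel function. [cite: CossartSchober2020, Def. 4.3] -/
def iotaC {ν : Type*} (zero : ν) (c : HSCase) (datumIII : IotaC ν) : IotaC ν :=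
  match c with
  | .IV => IotaC.mk zero 0 0 0 0 0
  | .V => IotaC.mk zero 0 0 0 0 0
  | .I => IotaC.mk zero 0 0 0 0 1
  | .II => IotaC.mk zero 0 0 0 0 1
  | .III => datumIII

/-- Definitions 5.1 and 5.5: `ι_poly` from `e^O_X(x)`, `δ^O_X(x)` (used when `e^O_X(x) = 1`),
whether (ALL_Irred_NEW) holds, and the list of tuples `(β_i^O, γ_i^O, σ_i^O, α_i^O)` of the new
boundary components `V(u_i) ∈ N(x)` (used when `e^O_X(x) = 2`; `inf_lex` over the list; the empty
list is `|N(x)| = 0`). [cite: CossartSchober2020, Def. 5.1, Def. 5.5] -/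
def iotaPoly (eO : ℕ) (δO : Qinf) (allIrredNew : Bool) (perNew : List IotaPolyVal) :
    IotaPolyVal :=
  if eO = 0 then IotaPolyVal.mk 0 0 0 0
  else if eO = 1 then IotaPolyVal.mk 0 0 0 δO
  else if !allIrredNew then IotaPolyVal.mk ⊤ ⊤ ⊤ ⊤
  else perNew.foldr min (IotaPolyVal.mk ⊤ ⊤ ⊤ ⊤)

/-- `(∞,∞,∞,∞)` is the top tuple: folding `min` from it realises `inf_lex`, and the empty list
(`|N(x)| = 0`) returns it, as Definition 5.5 prescribes. [cite: CossartSchober2020, Def. 5.5] -/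
theorem iotaPoly_nil (δO : Qinf) : iotaPoly 2 δO true [] = IotaPolyVal.mk ⊤ ⊤ ⊤ ⊤ := by
  simp [iotaPoly]

/-- In Cases (IV)/(V) the value of `ι_c` is below its value in Cases (I)/(II) (the last entry
`0 < 1`), which is what makes `ι` drop when the 𝓑-permissible `C` is blown up and left.
[cite: CossartSchober2020, Def. 4.3, proof of Prop. 4.5] -/
theorem iotaC_IV_lt_I {ν : Type*} [Preorder ν] (zero : ν) (d d' : IotaC ν) :
    iotaC zero .IV d < iotaC zero .I d' := by
  simp only [iotaC, IotaC.mk, Prod.Lex.toLex_lt_toLex, lt_self_iff_false, true_and, false_or]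
  exact WithTop.coe_lt_coe.2 (by norm_num)

/-- "`x'` lies above `x`": the data over which Theorem 1 is stated — the points of all the
schemes of a blow-up sequence following the algorithm of [CJS] for a reduced excellent scheme of
dimension at most two with boundary, the relation "`x ∈ D` and `x' ∈ π⁻¹(x)` for one blow-up
`π` of the sequence with its [CJS] centre `D`", and the invariant `ι`.  The structure records the
SHAPE of these data only; it asserts nothing about [CJS]. [cite: CossartSchober2020, §1, §4 (4.0)] -/
structure SequenceData (ν : Type*) [LT ν] where
  /-- points of the schemes `X, X', X'', …` of the sequence -/
  Point : Type*
  /-- `above x x'` : `x ∈ D` and `x' ∈ π_Z⁻¹(x)` for a blow-up `π_Z` of the sequence -/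
  above : Point → Point → Prop
  /-- the invariant `ι(X_n, 𝓑_n, x)` at a point of `X_n` -/
  iota : Point → Iota ν

/-- `f` strictly decreases along the relation `above`: `above x x' → f x' < f x`.
[cite: CossartSchober2020, Theorem 1] -/
def StrictlyDecreasesAlong {P I : Type*} [LT I] (above : P → P → Prop) (f : P → I) : Prop :=
  ∀ ⦃x x' : P⦄, above x x' → f x' < f x

/-- **[CS20] Theorem 1** as a named fact (NOT proved here): along a blow-up sequence following
the algorithm of [CJS] (dimension ≤ 2), `ι(X', 𝓑', x') < ι(X, 𝓑, x)` for every `x` in the centre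
and every `x'` above `x`. Use as a hypothesis `(h : Theorem1 S)`.
[cite: CossartSchober2020, Theorem 1] -/
def Theorem1 {ν : Type*} [LT ν] (S : SequenceData ν) : Prop :=
  StrictlyDecreasesAlong S.above S.iota

/-- The order-theoretic half of termination: a function with values in a well-founded order that
strictly decreases along `above` admits no infinite `above`-chain.  (For [CS20] this is how
Theorem 1 yields the finiteness of the [CJS] sequence at every point once the values of `ι` are
known to lie in a well-ordered set.) [cite: CossartSchober2020, §1 (discussion after Theorem 1)] -/
theorem no_infinite_chain {P I : Type*} [Preorder I] [WellFoundedLT I]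
    {above : P → P → Prop} {f : P → I} (h : StrictlyDecreasesAlong above f) :
    ¬ ∃ c : ℕ → P, ∀ n, above (c n) (c (n + 1)) := by
  rintro ⟨c, hc⟩
  have hdesc : ∀ n, f (c (n + 1)) < f (c n) := fun n => h (hc n)
  exact (wellFounded_iff_isEmpty_descending_chain.1 (wellFounded_lt (α := I))).false
    ⟨f ∘ c, hdesc⟩

/-- The GRID of values actually taken: Hilbert–Samuel entries in `ν`, natural entries, and the
rational entries replaced by numerators over a fixed denominator (`ℕ∞ = WithTop ℕ`), ordered
lexicographically exactly like `Iota ν`. [cite: CossartSchober2020, Cor. 3.10 / Def. 3.9 (`δ ∈ (1/N!)·ℤ_{≥0} ∪ {∞}`)] -/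
abbrev IotaGrid (ν : Type*) :=
  (ν ×ₗ ℕ ×ₗ ℕ ×ₗ ℕ) ×ₗ (ν ×ₗ ℕ ×ₗ ℕ ×ₗ ℕ ×ₗ WithTop ℕ ×ₗ WithTop ℕ) ×ₗ
    (WithTop ℕ ×ₗ WithTop ℕ ×ₗ WithTop ℕ ×ₗ WithTop ℕ)

/-- The grid is well-founded when the Hilbert–Samuel value type is (lexicographic products and
`WithTop` of well-founded orders are well-founded — Mathlib instances).
[cite: CossartSchober2020, §1] -/
instance instWellFoundedLTIotaGrid (ν : Type*) [LT ν] [WellFoundedLT ν] :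
    WellFoundedLT (IotaGrid ν) := inferInstance

/-- Embedding of a grid entry `k/N` (or `∞`) into `ℚ_∞`. [cite: CossartSchober2020, Def. 3.9] -/
def gridEntry (N : ℕ) : WithTop ℕ → Qinf
  | ⊤ => ⊤
  | (k : ℕ) => ((k : ℚ) / N : ℚ)

/-- For `N ≥ 1` the grid embedding of one entry is strictly monotone, so comparisons of `ι` can
be read off the grid. [cite: CossartSchober2020, Def. 3.9] -/
theorem gridEntry_strictMono {N : ℕ} (hN : 0 < N) : StrictMono (gridEntry N) := by
  intro a b hab
  cases a with
  | top => exact absurd hab (not_top_lt)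
  | coe a =>
    cases b with
    | top => exact WithTop.coe_lt_top _
    | coe b =>
      simp only [gridEntry]
      exact WithTop.coe_lt_coe.2
        (div_lt_div_of_pos_right (by exact_mod_cast WithTop.coe_lt_coe.1 hab) (by exact_mod_cast hN))

/-- Termination on the grid: if `ι` strictly decreases along `above` (Theorem 1) and every value is
read through a strictly monotone map from a well-founded grid (`g` with `S.iota = emb ∘ g`), there is
no infinite chain of points each lying above the previous one.
[cite: CossartSchober2020, Theorem 1 and §1] -/
theorem no_infinite_chain_of_grid {ν : Type*} [Preorder ν] [WellFoundedLT ν] {G : Type*}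
    [Preorder G] [WellFoundedLT G] (S : SequenceData ν) (g : S.Point → G) (emb : G → Iota ν)
    (hemb : ∀ a b, emb a < emb b → a < b) (hg : ∀ x, S.iota x = emb (g x)) (h : Theorem1 S) :
    ¬ ∃ c : ℕ → S.Point, ∀ n, S.above (c n) (c (n + 1)) := by
  refine no_infinite_chain (f := g) (above := S.above) ?_
  intro x x' hx
  have := h hx
  rw [hg x, hg x'] at this
  exact hemb _ _ this

end Literature.AlgebraicGeometry.Resolution.CossartSchober
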